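import Mathlib
import HarnessLib
import Literature.Combinatorics.Additive.StepBeyondKempermanETransform
import Literature.Combinatorics.Additive.NearlyPeriodicSummands
import Literature.Combinatorics.Additive.StepBeyondKempermanCore

/-!
# Grynkiewicz 2009, §6 CASE I, Subcase 1: `A(e) + B(e)` periodic

[cite: Grynkiewicz2009, §6 Subcase 1 (proof of Thm 4.1, pp. 29–31)] [tag: critical-pair] [tag: inverse-theorem]

Topic `Literature/Combinatorics/Additive`.  Cell `mm-stpp` (D-0046), seat `mm-stpp-lit` (gen 25); the
port of D. J. Grynkiewicz, *A step beyond Kemperman's structure theorem*, Mathematika **55** (2009)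
67–114 continued.  §6, CASE I (`G` finite), after the choice of `e` and Claim 11
(`StepBeyondKempermanETransform.lean`): **Subcase 1** (print pp. 29 bottom – 31 top; = arXiv:0710.1041v2
«Case 1», whose wording keeps the general `e` and the overlines):

«Subcase 1: `A(e) + B(e)` is periodic.  Let `H = H(A(e) + B(e))`, let `ρ` be the number of `H`-holes
contained in the pair `A(e)` and `B(e)` … Partition the set `A` into the disjoint sets `A ∩ B`, `A₁` and
`A₂`, where `A₁ = (A ∩ (B + H)) ∖ (A ∩ B)`, and where `A₂` are the remaining elements of `A`.  Likewise
partition the set `B = (A ∩ B) ∪ B₁ ∪ B₂` … (53) `ρ = ρ″ + |H|·|φ_H(A₁)| − |A₁| − |B₁| ≥ ρ″`.  Applying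
Kneser's Theorem to `(A(e), B(e))`, it follows that (54) `|A(e) + B(e)| ≥ |A| + |B| − |H| + ρ`.  Suppose
that there is some `b′ ∈ B₂` with `|φ_H(B_{b′} + A) ∖ φ_H(A(e) + B(e))| = t ≥ 1` … whence `A + B` is
quasi-periodic, a contradiction to (45).  So … the non-extendibility of `B` implies `B₂` is `H`-periodic
(or empty) … and that `A₂` is `H`-periodic (or empty).  Consequently `ρ″ = 0`.  Let
`A₁ = A_{α₁} ∪ … ∪ A_{αₙ}` and `B₁ = B_{β₁} ∪ … ∪ B_{βₙ}` be `H`-coset decompositions … with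
`φ_H(αᵢ) = φ_H(βᵢ)`.  In view of the result of the previous paragraph, Claim 11 and Lemma 5.6 … it
follows that `n ≥ 3`, else the proof is complete.  Note that `e′ ∈ A_{αᵢ} − B_{βᵢ} ⊆ H` are exactly
those elements such that `(e′ + B_{βᵢ}) ∩ A_{αᵢ}` is nonempty … unless `e′ + B ⊆ A`, then the element
`e′` will contradict the maximality of `e` … (a) `B₂` empty …, (b) `e′ + B_{βᵢ} ⊆ A_{αᵢ}` …, (c)
`A_{αᵢ} − B_{βᵢ} = A_{αⱼ} − B_{βⱼ}` … Consequently, the `A_{αᵢ}` are all just translates of one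
another, implying that `H(A_{αᵢ}) = H(A_{αⱼ}) = H′ ≤ H` … `A` is `H′`-periodic, whence `|H′| = 1`.
Hence … `|B_{βᵢ}| = 1` for all `i`.  For each partially filled `H`-coset `Fᵢ` in `A + B` … there are at
least two distinct partially filled `H`-cosets in `A + B`.  In view of the non-extendibility of `A` …
each `A_{αᵢ}` must have a `B_{β_σ(i)}` such that `A_{αᵢ} + B_{β_σ(i)} ⊆ F_j` … Hence in view of
Proposition 5.5 and `n ≥ 3` … (55)
`|A + B| ≥ |A(e) + B(e)| + |A_{αᵢ} + B_{βⱼ}| + |A_{αᵢ′} + B_{βⱼ′}| ≥ |A| + |B| + ρ + |A_{αᵢ}| + |A_{αᵢ′}| − |H|`,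
with equality possible only if there are exactly two partially filled `H`-cosets in `A + B`. …
Thus (55) implies `|A + B| ≥ |A| + |B| + |H| − 2`, whence `|H| = 2` … it follows that
`d⊆(A + B, 𝒫_H) ≤ 2`, contradicting that `d⊆(A + B, 𝒫) ≥ 3` (Claim 5).  So we may assume
`A(e) + B(e)` is aperiodic.»

FORMALIZATION.  As for Subcase 3 (`StepBeyondKempermanSubcaseThree.lean`) the counting is done for the
TRANSLATED pair: `B` below stands for `e + B`, so that `A(e) = B ∪ A`, `B(e) = B ∩ A`, and the
maximality of `e` reads `hmax : ∀ x, ¬ (x + B ⊆ A) → |(x + B) ∩ A| ≤ |B ∩ A|`.  The subgroup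
`H = H(A(e) + B(e))` is carried as the finset `Hf = (A(e) + B(e)).addStab` together with the stabilizer
subgroup `H` (`hHf : g ∈ Hf ↔ g ∈ H`), as in the Lemma 5.6 files.  The sets `A ∩ B`, `A₂`, `A₁`,
`A_{α}`, `B_{β}` of the print are `B ∩ A`, `{a ∈ A ∖ B | (a + H) ∩ B = ∅}`, `{a ∈ A ∖ B | (a + H) ∩ B ≠ ∅}`,
`A ∩ (a + Hf)`, `B ∩ (a + Hf)`; the hole counts (53)–(55) are replaced by the two instances actually used
(the coset of one `b′ ∈ B₂`, resp. the two cosets `αᵢ + H`, `αᵢ′ + H`), so `ρ`, `ρ′`, `ρ″` do not appear.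
The case `n ≤ 2` is returned as the nearly-periodic shape `A = A′ ∪ A₁ ∪ A₂` of Lemma 5.6
(`A′ = (B ∩ A) ∪ A₂`, `K = H(A′) ⊇ H`), and the wrapper `subcaseOne_seventeen` (original pair, general
`e`) feeds it to `seventeen_of_nearly_periodic` (Lemma 5.6) to obtain (17).

MAIN RESULTS (0 definitions, 0 named facts; everything PROVED).
* `Grynkiewicz2009.sc1_vadd_subset_of_disjoint`, `sc1_add_mem_of_disjoint` — «`φ_H(B_{b′} + A) ⊆
  φ_H(A(e) + B(e))` for all `b′ ∈ B₂`, whence … `B₂` is `H`-periodic».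
* `Grynkiewicz2009.sc1_vadd_subset_of_max` — the maximality of `e`: «unless `e′ + B ⊆ A`, the element
  `e′` will contradict the maximality of `e`»; `sc1_vadd_trace_eq` — «the `A_{αᵢ}` are all just translates
  of one another»; `sc1_inter_coset_eq_singleton` — «`|B_{βᵢ}| = 1` for all `i`».
* `Grynkiewicz2009.sc1_false_of_three_le` — `n ≥ 3` is impossible ((55), Proposition 5.5, Claim 5).
* **`Grynkiewicz2009.subcaseOne_nearlyPeriodic`** — Subcase 1 for the translated pair: `A` has the
  nearly periodic shape of Lemma 5.6.
* **`Grynkiewicz2009.subcaseOne_seventeen`** — **Subcase 1** as used by the induction: for the original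
  pair `(A, B)` (finite `G`, `0 ∈ A ∩ B`, `|A|, |B| ≥ 3`, `|A + B| = |A| + |B|`, `d⊆(A + B, 𝒫) ≥ 3`,
  `(A, B)` non-extendible, `⟨A⟩ = G`, `A` not quasi-periodic, `A + B` not quasi-periodic) and a maximal
  admissible `e` with `A(e) + B(e)` periodic, (17) holds.  No induction hypothesis is involved.

## References
* D. J. Grynkiewicz, *A step beyond Kemperman's structure theorem*, Mathematika 55 (2009) 67–114,
  doi:10.1112/S0025579300000966, §6 Subcase 1 (pp. 29–31) [cite: Grynkiewicz2009, Thm 4.1 (proof,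
  Subcase 1)] — held `paper:doi-10-1112-s0025579300000966`, p0029–p0031 read 2026-08-29; arXiv:0710.1041v2
  «Case 1» (held `paper:arxiv-0710.1041`, p0025–p0026) for the un-translated wording.
-/

namespace Literature.Combinatorics.Additive

open Finset
open scoped Pointwise

universe u

variable {G : Type u} [AddCommGroup G] [DecidableEq G]

namespace Grynkiewicz2009

/-! ### Cosets carried as finsets -/

/-- Membership in the coset finset `x + Hf`. [cite: Grynkiewicz2009, §2] -/
private theorem sc1_mem_coset_iff {Hf : Finset G} {H : AddSubgroup G} (hHf : ∀ g, g ∈ Hf ↔ g ∈ H)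
    {x z : G} : z ∈ x +ᵥ Hf ↔ z - x ∈ H := by
  constructor
  · intro hz
    obtain ⟨h, hh, rfl⟩ := mem_vadd_finset.1 hz
    rw [vadd_eq_add, add_sub_cancel_left]
    exact (hHf h).1 hh
  · intro hz
    exact mem_vadd_finset.2 ⟨z - x, (hHf _).2 hz, by rw [vadd_eq_add, add_sub_cancel]⟩

/-- `x ∈ x + Hf`. [cite: Grynkiewicz2009, §2] -/
private theorem sc1_self_mem_coset {Hf : Finset G} {H : AddSubgroup G} (hHf : ∀ g, g ∈ Hf ↔ g ∈ H)
    (x : G) : x ∈ x +ᵥ Hf :=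
  (sc1_mem_coset_iff hHf).2 (by rw [sub_self]; exact H.zero_mem)

/-- Two coset finsets with congruent base points coincide. [cite: Grynkiewicz2009, §2] -/
private theorem sc1_coset_eq_of_sub_mem {Hf : Finset G} {H : AddSubgroup G}
    (hHf : ∀ g, g ∈ Hf ↔ g ∈ H) {x y : G} (hxy : x - y ∈ H) : x +ᵥ Hf = y +ᵥ Hf := by
  ext z
  rw [sc1_mem_coset_iff hHf, sc1_mem_coset_iff hHf]
  constructor
  · intro hz
    have := H.add_mem hz hxy
    rwa [sub_add_sub_cancel] at this
  · intro hz
    have := H.sub_mem hz hxy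
    rwa [sub_sub_sub_cancel_right] at this

/-- An `Hf`-periodic finset is closed under adding elements of `Hf` (membership form).
[cite: Grynkiewicz2009, §2] -/
private theorem sc1_add_mem_of_periodic {Hf S : Finset G} (hSper : ∀ h ∈ Hf, h +ᵥ S = S) {h z : G}
    (hh : h ∈ Hf) (hz : z ∈ S) : h + z ∈ S := by
  rw [← hSper h hh]; exact mem_vadd_finset.2 ⟨z, hz, rfl⟩

/-- An `Hf`-periodic finset contains, with a point, its whole coset. [cite: Grynkiewicz2009, §2] -/
private theorem sc1_coset_subset_of_periodic {Hf S : Finset G}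
    (hSper : ∀ h ∈ Hf, h +ᵥ S = S) {z w : G} (hz : z ∈ S)
    (hw : w ∈ z +ᵥ Hf) : w ∈ S := by
  obtain ⟨h, hh, rfl⟩ := mem_vadd_finset.1 hw
  rw [vadd_eq_add, add_comm]
  exact sc1_add_mem_of_periodic hSper hh hz

/-! ### (52) and «`B₂` is `H`-periodic» -/

/-- (52) for the translated pair: `A(e) + B(e) = (B ∪ A) + (B ∩ A) ⊆ A + B`.
[cite: Grynkiewicz2009, §6 (CASE I, display (52))] -/
theorem sc1_union_add_inter_subset (A B : Finset G) : (B ∪ A) + (B ∩ A) ⊆ A + B := by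
  intro z hz
  obtain ⟨x, hx, y, hy, rfl⟩ := mem_add.1 hz
  rw [mem_inter] at hy
  rcases mem_union.1 hx with hx | hx
  · rw [add_comm x y]; exact add_mem_add hy.2 hx
  · exact add_mem_add hx hy.1

/-- **«`φ_H(B_{b′} + A) ⊆ φ_H(A(e) + B(e))` for all `b′ ∈ B₂`»** (print p. 30).  For the translated pair,
with `S = A(e) + B(e)` periodic with period finset `Hf` (subgroup `H ≠ 0`), `S ⊆ A + B`, Kneser's
inequality (54) for `(A(e), B(e))` in the form `|A(e) + H| + |B(e)| ≤ |S| + |H|`, `|A + B| = |A| + |B|`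
and `A + B` not quasi-periodic ((45)): if `b₀ ∈ B` has its `H`-coset disjoint from `A`, then
`b₀ + A ⊆ S`.  («Suppose that there is some `b′ ∈ B₂` with … `t ≥ 1`.  Thus `ρ″ ≥ |H| − |B_{b′}|`.  Hence
… `|A + B| ≥ |A(e) + B(e)| + t|B_{b′}| ≥ |A| + |B| − |H| + ρ″ + |B_{b′}| ≥ |A| + |B|`, whence equality
holds … `A + B = (A(e) + B(e)) ∪ (B_{b′} + A)`, whence `A + B` is quasi-periodic, a contradiction.»)
[cite: Grynkiewicz2009, §6 Subcase 1 (p. 30)] -/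
theorem sc1_vadd_subset_of_disjoint {A B S Hf : Finset G} {H : AddSubgroup G}
    (hHf : ∀ g, g ∈ Hf ↔ g ∈ H) (hH : H ≠ ⊥)
    (hSper : ∀ h ∈ Hf, h +ᵥ S = S) (hSne : S.Nonempty) (hSsub : S ⊆ A + B)
    (kn : #((B ∪ A) + Hf) + #(B ∩ A) ≤ #S + #Hf)
    (hAB : #(A + B) = #A + #B) (hABqp : ¬ IsQuasiPeriodic (A + B))
    {b₀ : G} (hb₀ : b₀ ∈ B) (hdisj : Disjoint (b₀ +ᵥ Hf) A) : b₀ +ᵥ A ⊆ S := by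
  by_contra hnot
  obtain ⟨z, hz, hzS⟩ := not_subset.1 hnot
  obtain ⟨a, ha, rfl⟩ := mem_vadd_finset.1 hz
  -- `T = B_{b₀}`, the trace of `B` on the coset of `b₀`
  set T : Finset G := B ∩ (b₀ +ᵥ Hf) with hT
  have hTsub : T ⊆ b₀ +ᵥ Hf := inter_subset_right
  -- `a + T ⊆ A + B` lies in a coset disjoint from `S`
  have haT : a +ᵥ T ⊆ A + B := by
    intro w hw
    obtain ⟨t, ht, rfl⟩ := mem_vadd_finset.1 hw
    exact add_mem_add ha (mem_inter.1 ht).1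
  have hdisjST : Disjoint S (a +ᵥ T) := by
    rw [disjoint_right]
    intro w hw hwS
    obtain ⟨t, ht, rfl⟩ := mem_vadd_finset.1 hw
    obtain ⟨h, hh, rfl⟩ := mem_vadd_finset.1 (mem_inter.1 ht).2
    have hneg : -h ∈ Hf := (hHf _).2 (H.neg_mem ((hHf h).1 hh))
    have hmem := sc1_add_mem_of_periodic hSper hneg hwS
    have e : -h + (a +ᵥ (b₀ +ᵥ h)) = b₀ +ᵥ a := by simp only [vadd_eq_add]; abel
    rw [e] at hmem
    exact hzS hmem
  have hcount : #S + #T ≤ #(A + B) := by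
    rw [← card_vadd_finset a T, ← card_union_of_disjoint hdisjST]
    exact card_le_card (union_subset hSsub haT)
  -- the holes of `A(e) = B ∪ A` in the coset of `b₀`: at least `|H| − |T|`
  have hholes : #(B ∪ A) + #Hf ≤ #((B ∪ A) + Hf) + #T := by
    have h0 : (0 : G) ∈ Hf := (hHf 0).2 H.zero_mem
    have hsub1 : B ∪ A ⊆ (B ∪ A) + Hf := fun x hx => mem_add.2 ⟨x, hx, 0, h0, add_zero x⟩
    have hsub2 : (b₀ +ᵥ Hf) \ T ⊆ (B ∪ A) + Hf := by
      intro x hx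
      obtain ⟨h, hh, rfl⟩ := mem_vadd_finset.1 (mem_sdiff.1 hx).1
      exact mem_add.2 ⟨b₀, mem_union_left _ hb₀, h, hh, rfl⟩
    have hdisj2 : Disjoint (B ∪ A) ((b₀ +ᵥ Hf) \ T) := by
      rw [disjoint_right]
      intro x hx hxBA
      rw [mem_sdiff] at hx
      rcases mem_union.1 hxBA with hxB | hxA
      · exact hx.2 (mem_inter.2 ⟨hxB, hx.1⟩)
      · exact disjoint_left.1 hdisj hx.1 hxA
    have := card_le_card (union_subset hsub1 hsub2)
    rw [card_union_of_disjoint hdisj2, card_sdiff_of_subset hTsub, card_vadd_finset] at this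
    have hTle : #T ≤ #Hf := by
      calc #T ≤ #(b₀ +ᵥ Hf) := card_le_card hTsub
        _ = #Hf := card_vadd_finset _ _
    omega
  have hui : #(B ∪ A) + #(B ∩ A) = #B + #A := card_union_add_card_inter B A
  -- equality throughout: `A + B = S ∪ (a + T)`
  have hABeq : S ∪ (a +ᵥ T) = A + B :=
    eq_of_subset_of_card_le (union_subset hSsub haT)
      (by rw [card_union_of_disjoint hdisjST, card_vadd_finset]; omega)
  apply hABqp
  rw [← hABeq]
  refine isQuasiPeriodic_union_of_isPeriodicWith hH (fun h hh => hSper h ((hHf h).2 hh)) hSne ?_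
  intro x hx y hy
  obtain ⟨t, ht, rfl⟩ := mem_vadd_finset.1 hx
  obtain ⟨t', ht', rfl⟩ := mem_vadd_finset.1 hy
  obtain ⟨h, hh, rfl⟩ := mem_vadd_finset.1 (mem_inter.1 ht).2
  obtain ⟨h', hh', rfl⟩ := mem_vadd_finset.1 (mem_inter.1 ht').2
  have e : (a +ᵥ (b₀ +ᵥ h)) - (a +ᵥ (b₀ +ᵥ h')) = h - h' := by simp only [vadd_eq_add]; abel
  rw [e]
  exact H.sub_mem ((hHf h).1 hh) ((hHf h').1 hh')

/-- **«whence the non-extendibility of `B` implies `B₂` is `H`-periodic (or empty)»** (print p. 30): under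
the hypotheses of `sc1_vadd_subset_of_disjoint` and `(B, A)` non-extendible, the `H`-coset of every
`b₀ ∈ B` whose coset misses `A` lies in `B`. [cite: Grynkiewicz2009, §6 Subcase 1 (p. 30)] -/
theorem sc1_add_mem_of_disjoint {A B S Hf : Finset G} {H : AddSubgroup G}
    (hHf : ∀ g, g ∈ Hf ↔ g ∈ H) (hH : H ≠ ⊥)
    (hSper : ∀ h ∈ Hf, h +ᵥ S = S) (hSne : S.Nonempty) (hSsub : S ⊆ A + B)
    (kn : #((B ∪ A) + Hf) + #(B ∩ A) ≤ #S + #Hf)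
    (hAB : #(A + B) = #A + #B) (hABqp : ¬ IsQuasiPeriodic (A + B)) (hneB : IsNonExtendible B A)
    {b₀ : G} (hb₀ : b₀ ∈ B) (hdisj : Disjoint (b₀ +ᵥ Hf) A) {h : G} (hh : h ∈ Hf) : h + b₀ ∈ B := by
  have hsub := sc1_vadd_subset_of_disjoint hHf hH hSper hSne hSsub kn hAB hABqp hb₀ hdisj
  by_contra hnot
  apply hneB _ hnot
  refine Subset.antisymm ?_ (add_subset_add_right (subset_insert _ _))
  intro z hz
  obtain ⟨u, hu, a, ha, rfl⟩ := mem_add.1 hz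
  rcases mem_insert.1 hu with rfl | hu
  · have h1 : b₀ +ᵥ a ∈ S := hsub (mem_vadd_finset.2 ⟨a, ha, rfl⟩)
    have h2 := sc1_add_mem_of_periodic hSper hh h1
    have e : h + b₀ + a = h + (b₀ +ᵥ a) := by simp only [vadd_eq_add]; abel
    rw [e, add_comm B A]
    exact hSsub h2
  · exact add_mem_add hu ha

/-! ### The maximality of `e` -/

/-- **The maximality of `e`** (print p. 30): «Note that `e′ ∈ A_{αᵢ} − B_{βᵢ} ⊆ H` are exactly those
elements such that `(e′ + B_{βᵢ}) ∩ A_{αᵢ}` is nonempty.  Additionally, since `A ∩ B` is `H`-periodic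
(Claim 11), and since `e′ ∈ H`, it follows that `((e′ + B_{βᵢ}) ∩ A_{αᵢ}) ∪ (A ∩ B) ⊆ A ∩ (e′ + B)`.
Thus … unless `e′ + B ⊆ A`, then the element `e′` will contradict the maximality of `e = 0`.»  For the
translated pair: if `a′ ∈ A ∖ B`, `b′ ∈ B` and `a′ − b′ ∈ H`, then `(a′ − b′) + B ⊆ A`.
[cite: Grynkiewicz2009, §6 Subcase 1 (p. 30)] -/
theorem sc1_vadd_subset_of_max {A B Hf : Finset G} {H : AddSubgroup G}
    (hHf : ∀ g, g ∈ Hf ↔ g ∈ H) (hYper : ∀ h ∈ Hf, h +ᵥ (B ∩ A) = B ∩ A)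
    (hmax : ∀ x : G, ¬ (x +ᵥ B ⊆ A) → #((x +ᵥ B) ∩ A) ≤ #(B ∩ A))
    {a' b' : G} (ha' : a' ∈ A) (ha'B : a' ∉ B) (hb' : b' ∈ B) (hab : a' - b' ∈ H) :
    (a' - b') +ᵥ B ⊆ A := by
  by_contra hnot
  have hle := hmax _ hnot
  have hsub : insert a' (B ∩ A) ⊆ ((a' - b') +ᵥ B) ∩ A := by
    rw [insert_subset_iff]
    refine ⟨mem_inter.2 ⟨mem_vadd_finset.2 ⟨b', hb', by rw [vadd_eq_add, sub_add_cancel]⟩, ha'⟩, ?_⟩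
    intro y hy
    have hneg : -(a' - b') ∈ Hf := (hHf _).2 (H.neg_mem hab)
    have hy' := sc1_add_mem_of_periodic hYper hneg hy
    refine mem_inter.2 ⟨mem_vadd_finset.2 ⟨_, (mem_inter.1 hy').1, ?_⟩, (mem_inter.1 hy).2⟩
    simp only [vadd_eq_add]; abel
  have := card_le_card hsub
  rw [card_insert_of_notMem (fun h => ha'B (mem_inter.1 h).1)] at this
  omega

/-- If `x ∈ A` is congruent modulo `H` to some `a ∉ B`, then `x ∉ B` (otherwise the `H`-periodic set
`B ∩ A` would contain the whole coset, in particular `a`); i.e. the traces `A_{αᵢ}` are disjoint from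
`B`. [cite: Grynkiewicz2009, §6 Subcase 1 (p. 30)] -/
theorem sc1_notMem_of_sub_mem {A B Hf : Finset G} {H : AddSubgroup G}
    (hHf : ∀ g, g ∈ Hf ↔ g ∈ H) (hYper : ∀ h ∈ Hf, h +ᵥ (B ∩ A) = B ∩ A)
    {a x : G} (haB : a ∉ B) (hx : x ∈ A) (hxa : x - a ∈ H) : x ∉ B := by
  intro hxB
  apply haB
  have hax : a - x ∈ Hf := (hHf _).2 (by have := H.neg_mem hxa; rwa [neg_sub] at this)
  have hmem := sc1_add_mem_of_periodic hYper hax (mem_inter.2 ⟨hxB, hx⟩)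
  rw [sub_add_cancel] at hmem
  exact (mem_inter.1 hmem).1

/-- **(a) «`B₂` empty»** (print p. 30): if some `a ∈ A ∖ B` has a point `b′` of `B` in its `H`-coset,
then every `H`-coset of a point of `B` meets `A` («else w.l.o.g. there will be an `H`-coset `β + H` which
intersects `e′ + B` but not `A`»). [cite: Grynkiewicz2009, §6 Subcase 1 (p. 30, (a))] -/
theorem sc1_inter_nonempty {A B Hf : Finset G} {H : AddSubgroup G}
    (hHf : ∀ g, g ∈ Hf ↔ g ∈ H) (hYper : ∀ h ∈ Hf, h +ᵥ (B ∩ A) = B ∩ A)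
    (hmax : ∀ x : G, ¬ (x +ᵥ B ⊆ A) → #((x +ᵥ B) ∩ A) ≤ #(B ∩ A))
    {a b' : G} (ha : a ∈ A) (haB : a ∉ B) (hb' : b' ∈ B) (hab : a - b' ∈ H)
    {b : G} (hb : b ∈ B) : ((b +ᵥ Hf) ∩ A).Nonempty := by
  refine ⟨(a - b') + b, mem_inter.2 ⟨mem_vadd_finset.2 ⟨a - b', (hHf _).2 hab, ?_⟩,
    sc1_vadd_subset_of_max hHf hYper hmax ha haB hb' hab (mem_vadd_finset.2 ⟨b, hb, rfl⟩)⟩⟩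
  rw [vadd_eq_add, add_comm]

/-! ### The traces `A_{αᵢ}` are translates of one another; `|B_{βᵢ}| = 1` -/

/-- **(b), (c) ⟹ «the `A_{αᵢ}` are all just translates of one another»** (print p. 30), inclusion form:
for `a ∈ A ∖ B` with `b ∈ B` in its coset and any `b″ ∈ B` in the coset of `a″`,
`(b″ − b) + A_{a} ⊆ A_{a″}` (from the maximality of `e`: `e′ = x − b` has `e′ + B ⊆ A`).
[cite: Grynkiewicz2009, §6 Subcase 1 (p. 30, (b)–(c))] -/
theorem sc1_vadd_trace_subset {A B Hf : Finset G} {H : AddSubgroup G}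
    (hHf : ∀ g, g ∈ Hf ↔ g ∈ H) (hYper : ∀ h ∈ Hf, h +ᵥ (B ∩ A) = B ∩ A)
    (hmax : ∀ x : G, ¬ (x +ᵥ B ⊆ A) → #((x +ᵥ B) ∩ A) ≤ #(B ∩ A))
    {a a'' b b'' : G} (haB : a ∉ B) (hb : b ∈ B ∩ (a +ᵥ Hf)) (hb'' : b'' ∈ B ∩ (a'' +ᵥ Hf)) :
    (b'' - b) +ᵥ (A ∩ (a +ᵥ Hf)) ⊆ A ∩ (a'' +ᵥ Hf) := by
  intro z hz
  obtain ⟨x, hx, rfl⟩ := mem_vadd_finset.1 hz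
  rw [mem_inter] at hx hb hb''
  have hxa : x - a ∈ H := (sc1_mem_coset_iff hHf).1 hx.2
  have hba : b - a ∈ H := (sc1_mem_coset_iff hHf).1 hb.2
  have hxB : x ∉ B := sc1_notMem_of_sub_mem hHf hYper haB hx.1 hxa
  have hxb : x - b ∈ H := by
    have := H.sub_mem hxa hba; rwa [sub_sub_sub_cancel_right] at this
  have hsub := sc1_vadd_subset_of_max hHf hYper hmax hx.1 hxB hb.1 hxb
  refine mem_inter.2 ⟨?_, ?_⟩
  · have : (x - b) +ᵥ b'' ∈ A := hsub (mem_vadd_finset.2 ⟨b'', hb''.1, rfl⟩)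
    have e : (b'' - b) +ᵥ x = (x - b) +ᵥ b'' := by simp only [vadd_eq_add]; abel
    rw [e]; exact this
  · rw [sc1_mem_coset_iff hHf]
    have hb''a : b'' - a'' ∈ H := (sc1_mem_coset_iff hHf).1 hb''.2
    have e : ((b'' - b) +ᵥ x) - a'' = (x - b) + (b'' - a'') := by simp only [vadd_eq_add]; abel
    rw [e]; exact H.add_mem hxb hb''a

/-- «The `A_{αᵢ}` are all just translates of one another»: `(b″ − b) + A_{a} = A_{a″}` for
`a, a″ ∈ A ∖ B` with `b ∈ B_{a}`, `b″ ∈ B_{a″}`. [cite: Grynkiewicz2009, §6 Subcase 1 (p. 30)] -/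
theorem sc1_vadd_trace_eq {A B Hf : Finset G} {H : AddSubgroup G}
    (hHf : ∀ g, g ∈ Hf ↔ g ∈ H) (hYper : ∀ h ∈ Hf, h +ᵥ (B ∩ A) = B ∩ A)
    (hmax : ∀ x : G, ¬ (x +ᵥ B ⊆ A) → #((x +ᵥ B) ∩ A) ≤ #(B ∩ A))
    {a a'' b b'' : G} (haB : a ∉ B) (ha''B : a'' ∉ B) (hb : b ∈ B ∩ (a +ᵥ Hf))
    (hb'' : b'' ∈ B ∩ (a'' +ᵥ Hf)) :
    (b'' - b) +ᵥ (A ∩ (a +ᵥ Hf)) = A ∩ (a'' +ᵥ Hf) := by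
  refine Subset.antisymm (sc1_vadd_trace_subset hHf hYper hmax haB hb hb'') ?_
  intro z hz
  have h1 := sc1_vadd_trace_subset hHf hYper hmax ha''B hb'' hb (mem_vadd_finset.2 ⟨z, hz, rfl⟩)
  refine mem_vadd_finset.2 ⟨_, h1, ?_⟩
  simp only [vadd_eq_add]; abel

/-- «implying that `H(A_{αᵢ}) = H(A_{αⱼ}) = H′ ≤ H` … Thus, since `A₂` is `H`-periodic (or empty), it
follows that `A` is `H′`-periodic»: the stabilizer of a trace `A_{a}`, `a ∈ A ∖ B` with `B_{a} ≠ ∅`, stabilizes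
`A` — given that `B ∩ A` is `H`-periodic (Claim 11) and that the cosets of `A` missing `B` lie in `A`
(`A₂` is `H`-periodic). [cite: Grynkiewicz2009, §6 Subcase 1 (p. 30)] -/
theorem sc1_addStab_trace_subset {A B Hf : Finset G} {H : AddSubgroup G}
    (hHf : ∀ g, g ∈ Hf ↔ g ∈ H) (hYper : ∀ h ∈ Hf, h +ᵥ (B ∩ A) = B ∩ A)
    (hmax : ∀ x : G, ¬ (x +ᵥ B ⊆ A) → #((x +ᵥ B) ∩ A) ≤ #(B ∩ A))
    (hA₂per : ∀ x ∈ A, Disjoint (x +ᵥ Hf) B → ∀ h ∈ Hf, h + x ∈ A)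
    {a b : G} (ha : a ∈ A) (haB : a ∉ B) (hb : b ∈ B ∩ (a +ᵥ Hf)) :
    (A ∩ (a +ᵥ Hf)).addStab ⊆ A.addStab := by
  intro g hg
  have hAane : (A ∩ (a +ᵥ Hf)).Nonempty := ⟨a, mem_inter.2 ⟨ha, sc1_self_mem_coset hHf a⟩⟩
  have hgH : g ∈ Hf := addStab_subset_of_subset_vadd hHf hAane inter_subset_right hg
  rw [mem_addStab ⟨a, ha⟩]
  refine eq_of_subset_of_card_le (fun z hz => ?_) (by rw [card_vadd_finset])
  obtain ⟨x, hx, rfl⟩ := mem_vadd_finset.1 hz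
  by_cases hxB : x ∈ B
  · exact (mem_inter.1 (sc1_add_mem_of_periodic hYper hgH (mem_inter.2 ⟨hxB, hx⟩))).2
  by_cases hdisj : Disjoint (x +ᵥ Hf) B
  · exact hA₂per x hx hdisj g hgH
  obtain ⟨b'', hb''⟩ : ∃ b'', b'' ∈ B ∩ (x +ᵥ Hf) := by
    obtain ⟨w, hw1, hw2⟩ := not_disjoint_iff.1 hdisj
    exact ⟨w, mem_inter.2 ⟨hw2, hw1⟩⟩
  have heq := sc1_vadd_trace_eq hHf hYper hmax haB hxB hb hb''
  have hxne : (A ∩ (x +ᵥ Hf)).Nonempty := ⟨x, mem_inter.2 ⟨hx, sc1_self_mem_coset hHf x⟩⟩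
  have hg' : g ∈ (A ∩ (x +ᵥ Hf)).addStab := by rw [← heq, addStab_vadd]; exact hg
  rw [mem_addStab hxne] at hg'
  have : g +ᵥ x ∈ g +ᵥ (A ∩ (x +ᵥ Hf)) :=
    mem_vadd_finset.2 ⟨x, mem_inter.2 ⟨hx, sc1_self_mem_coset hHf x⟩, rfl⟩
  rw [hg'] at this
  exact (mem_inter.1 this).1

/-- **«`|B_{βᵢ}| = 1` for all `i`»** (print p. 30): for `A` not quasi-periodic («whence `|H′| = 1`.  Hence
`B_{βᵢ} − B_{βᵢ} ⊆ H(A_{αᵢ}) = H′` implies that `|B_{βᵢ}| = 1`»), the trace of `B` on the coset of any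
`a ∈ A ∖ B` that it meets is a single point. [cite: Grynkiewicz2009, §6 Subcase 1 (p. 30)] -/
theorem sc1_inter_coset_eq_singleton {A B Hf : Finset G} {H : AddSubgroup G}
    (hHf : ∀ g, g ∈ Hf ↔ g ∈ H) (hYper : ∀ h ∈ Hf, h +ᵥ (B ∩ A) = B ∩ A)
    (hmax : ∀ x : G, ¬ (x +ᵥ B ⊆ A) → #((x +ᵥ B) ∩ A) ≤ #(B ∩ A))
    (hA₂per : ∀ x ∈ A, Disjoint (x +ᵥ Hf) B → ∀ h ∈ Hf, h + x ∈ A)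
    (hAqp : ¬ IsQuasiPeriodic A)
    {a b : G} (ha : a ∈ A) (haB : a ∉ B) (hb : b ∈ B ∩ (a +ᵥ Hf)) :
    B ∩ (a +ᵥ Hf) = {b} := by
  have hAne : A.Nonempty := ⟨a, ha⟩
  have hAane : (A ∩ (a +ᵥ Hf)).Nonempty := ⟨a, mem_inter.2 ⟨ha, sc1_self_mem_coset hHf a⟩⟩
  have htriv : (A ∩ (a +ᵥ Hf)).addStab = {0} := by
    by_contra hne
    apply hAqp
    have hsub := sc1_addStab_trace_subset hHf hYper hmax hA₂per ha haB hb
    have hAst : A.addStab ≠ {0} := by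
      intro h0
      apply hne
      refine Subset.antisymm (h0 ▸ hsub) ?_
      exact singleton_subset_iff.2 hAane.zero_mem_addStab
    exact ((isPeriodic_iff_addStab_ne hAne).2 hAst).isQuasiPeriodic hAne
  refine eq_singleton_iff_unique_mem.2 ⟨hb, fun b' hb' => ?_⟩
  have hmem : b' - b ∈ (A ∩ (a +ᵥ Hf)).addStab := by
    rw [mem_addStab hAane]
    exact eq_of_subset_of_card_le (sc1_vadd_trace_subset hHf hYper hmax haB hb hb')
      (by rw [card_vadd_finset])
  rw [htriv, mem_singleton, sub_eq_zero] at hmem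
  exact hmem

/-! ### `n ≥ 3` is impossible -/

/-- **«`n ≥ 3`» is impossible** (print pp. 30–31).  In the configuration reached above for the translated
pair — `S = A(e) + B(e)` periodic with period finset `Hf` (subgroup `H ≠ 0`), Kneser's (54), `B ∩ A`
`H`-periodic (Claim 11), `a + B ⊆ S` for every `a ∈ A` whose coset misses `B` (`A₂` side of
`sc1_vadd_subset_of_disjoint`), every coset of a point of `B` meeting `A` ((a)), `|B_{β}| = 1` for the
cosets of `A₁` (`sc1_inter_coset_eq_singleton`) — the set `A₁ = {a ∈ A ∖ B : (a + H) ∩ B ≠ ∅}` meets at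
most two `H`-cosets.  Printed argument: «For each partially filled `H`-coset `Fᵢ` in `A + B` … there must
be at least one pair `A_{αᵢ}` and `B_{βⱼ}` such that `A_{αᵢ} + B_{βⱼ} ⊆ Fᵢ`.  Since `A + B` is not
quasi-periodic … there are at least two distinct partially filled `H`-cosets in `A + B`.  In view of the
non-extendibility of `A`, it follows that each `A_{αᵢ}` must have a `B_{β_σ(i)}` such that
`A_{αᵢ} + B_{β_σ(i)} ⊆ F_j` for some `j`.  Likewise for each `B_{bᵢ}`.  Hence in view of Proposition 5.5
and `n ≥ 3`, it follows that there exist distinct `i` and `i′` and distinct `j` and `j′` such that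
`A_{αᵢ} + B_{βⱼ}` and `A_{αᵢ′} + B_{βⱼ′}` are each disjoint from `A(e) + B(e)` and
`φ_H(αᵢ + βⱼ) ≠ φ_H(αᵢ′ + βⱼ′)`.  Thus in view of (54) it follows that (55) … Thus (55) implies
`|A + B| ≥ |A| + |B| + |H| − 2`, whence `|H| = 2` and equality must hold in (55).  Hence there are
exactly two partially filled `H`-cosets in `A + B`.  Thus, since `|H| = 2` implies each partially filled
`H`-coset contains one hole, it follows that `d⊆(A + B, 𝒫_H) ≤ 2`, contradicting that
`d⊆(A + B, 𝒫) ≥ 3` (Claim 5).»  (Proposition 5.5 = `exists_two_edges_or_card_eq_two`, applied in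
`G ⧸ H` to `φ_H(A₁)`, `φ_H(B₁) = φ_H(A₁)` and the set of partially filled cosets.)
[cite: Grynkiewicz2009, §6 Subcase 1 (pp. 30–31)] -/
theorem sc1_false_of_three_le {A B S Hf A₁ : Finset G} {H : AddSubgroup G} [DecidableEq (G ⧸ H)]
    (hHf : ∀ g, g ∈ Hf ↔ g ∈ H) (hH : H ≠ ⊥)
    (hSper : ∀ h ∈ Hf, h +ᵥ S = S) (hSne : S.Nonempty) (hSdef : S = (B ∪ A) + (B ∩ A))
    (kn : #((B ∪ A) + Hf) + #(B ∩ A) ≤ #S + #Hf)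
    (hAB : #(A + B) = #A + #B) (hABqp : ¬ IsQuasiPeriodic (A + B))
    (hP3 : ∀ P : Finset G, A + B ⊆ P → P.addStab ≠ {0} → 3 ≤ #(P \ (A + B)))
    (hneA : IsNonExtendible A B) (hneB : IsNonExtendible B A)
    (hYper : ∀ h ∈ Hf, h +ᵥ (B ∩ A) = B ∩ A)
    (hA₂S : ∀ x ∈ A, Disjoint (x +ᵥ Hf) B → x +ᵥ B ⊆ S)
    (hB₂ : ∀ b ∈ B, ((b +ᵥ Hf) ∩ A).Nonempty)
    (hsingle : ∀ a ∈ A, a ∉ B → ∀ b ∈ B ∩ (a +ᵥ Hf), B ∩ (a +ᵥ Hf) = {b})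
    (hA₁ : ∀ a, a ∈ A₁ ↔ a ∈ A ∧ a ∉ B ∧ ((a +ᵥ Hf) ∩ B).Nonempty)
    (hn : 3 ≤ #(A₁.image (QuotientAddGroup.mk : G → G ⧸ H))) : False := by
  have ex : ∀ {p q : G}, (QuotientAddGroup.mk p : G ⧸ H) = QuotientAddGroup.mk q ↔ p - q ∈ H :=
    fun {p q} => QuotientAddGroup.eq_iff_sub_mem
  have hSsub : S ⊆ A + B := by rw [hSdef]; exact sc1_union_add_inter_subset A B
  have h0Hf : (0 : G) ∈ Hf := (hHf 0).2 H.zero_mem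
  obtain ⟨h₁, hh₁H, hh₁0⟩ : ∃ g ∈ H, g ≠ (0 : G) := by
    by_contra hne
    push Not at hne
    exact hH ((AddSubgroup.eq_bot_iff_forall _).2 hne)
  have hh₁ : h₁ ∈ Hf := (hHf _).2 hh₁H
  have hHf2 : 2 ≤ #Hf := by
    have : ({0, h₁} : Finset G) ⊆ Hf := by
      rw [insert_subset_iff, singleton_subset_iff]; exact ⟨h0Hf, hh₁⟩
    have h2 : #({0, h₁} : Finset G) = 2 := card_pair (Ne.symm hh₁0)
    exact h2 ▸ card_le_card this
  have hABne : (A + B).Nonempty := hSne.mono hSsub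
  have haper : (A + B).addStab = {0} := by
    by_contra hne
    have := hP3 (A + B) Subset.rfl hne
    rw [Finset.sdiff_self, card_empty] at this
    omega
  -- the sum of a point of `B ∪ A` and a point of `B ∩ A` lies in `S`
  have hmemS : ∀ u, u ∈ B ∪ A → ∀ v ∈ B ∩ A, u + v ∈ S := fun u hu v hv => by
    rw [hSdef]; exact add_mem_add hu hv
  -- the symmetric form of Claim 11 and «`A_{α} ∩ B = ∅`»
  have hxB_of : ∀ {b x : G}, b ∈ B → b ∉ A → x ∈ A → x - b ∈ H → x ∉ B := by
    intro b x hbB hbA hxA hxb hxB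
    apply hbA
    have hbx : b - x ∈ Hf := (hHf _).2 (by have := H.neg_mem hxb; rwa [neg_sub] at this)
    have hmem := sc1_add_mem_of_periodic hYper hbx (mem_inter.2 ⟨hxB, hxA⟩)
    rw [sub_add_cancel] at hmem
    exact (mem_inter.1 hmem).2
  -- partially filled cosets are disjoint from `S`
  have hpart : ∀ z : G, ¬ (z +ᵥ Hf ⊆ A + B) → Disjoint (z +ᵥ Hf) S := by
    intro z hz
    rw [disjoint_left]
    intro w hw hwS
    apply hz
    intro v hv
    have hvw : v ∈ w +ᵥ Hf := by
      rw [sc1_mem_coset_iff hHf] at hv hw ⊢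
      have := H.sub_mem hv hw; rwa [sub_sub_sub_cancel_right] at this
    exact hSsub (sc1_coset_subset_of_periodic hSper hwS hvw)
  -- the sets `B₁`, `𝒜 = φ_H(A₁)`, `ℬ = φ_H(B₁)`, `𝒞` = partially filled cosets
  set B₁ : Finset G := B.filter (fun b => b ∉ A) with hB₁def
  set 𝒜 : Finset (G ⧸ H) := A₁.image (QuotientAddGroup.mk : G → G ⧸ H) with h𝒜def
  set ℬ : Finset (G ⧸ H) := B₁.image (QuotientAddGroup.mk : G → G ⧸ H) with hℬdef
  set 𝒞 : Finset (G ⧸ H) :=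
    ((A + B).filter (fun c => ¬ (c +ᵥ Hf ⊆ A + B))).image (QuotientAddGroup.mk : G → G ⧸ H)
    with h𝒞def
  have hmem𝒞 : ∀ {c : G}, c ∈ A + B → ¬ (c +ᵥ Hf ⊆ A + B) → (QuotientAddGroup.mk c : G ⧸ H) ∈ 𝒞 :=
    fun {c} hc hcn => mem_image_of_mem _ (mem_filter.2 ⟨hc, hcn⟩)
  -- a point of `B` in the coset of an `a ∈ A₁` is not in `A`
  have hbA_of : ∀ {a b : G}, a ∉ B → b ∈ B → b ∈ a +ᵥ Hf → b ∉ A := by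
    intro a b haB hbB hba hbA
    exact sc1_notMem_of_sub_mem hHf hYper haB hbA ((sc1_mem_coset_iff hHf).1 hba) hbB
  -- `ℬ = 𝒜`
  have hℬ𝒜 : ℬ = 𝒜 := by
    ext q
    rw [hℬdef, h𝒜def, mem_image, mem_image]
    constructor
    · rintro ⟨b, hb, rfl⟩
      rw [hB₁def, mem_filter] at hb
      obtain ⟨x, hx⟩ := hB₂ b hb.1
      rw [mem_inter] at hx
      have hxb : x - b ∈ H := (sc1_mem_coset_iff hHf).1 hx.1
      have hxB : x ∉ B := hxB_of hb.1 hb.2 hx.2 hxb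
      have hbx : b ∈ x +ᵥ Hf := by
        rw [sc1_mem_coset_iff hHf]; have := H.neg_mem hxb; rwa [neg_sub] at this
      refine ⟨x, (hA₁ x).2 ⟨hx.2, hxB, ⟨b, mem_inter.2 ⟨hbx, hb.1⟩⟩⟩, ?_⟩
      exact ex.2 hxb
    · rintro ⟨a, ha, rfl⟩
      obtain ⟨haA, haB, ⟨b, hb⟩⟩ := (hA₁ a).1 ha
      rw [mem_inter] at hb
      have hbA : b ∉ A := hbA_of haB hb.2 hb.1
      refine ⟨b, by rw [hB₁def, mem_filter]; exact ⟨hb.2, hbA⟩, ?_⟩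
      exact ex.2 ((sc1_mem_coset_iff hHf).1 hb.1)
  -- `𝒞 ⊆ 𝒜 + ℬ`
  have h𝒞sub : 𝒞 ⊆ 𝒜 + ℬ := by
    intro q hq
    rw [h𝒞def, mem_image] at hq
    obtain ⟨c, hc, rfl⟩ := hq
    rw [mem_filter] at hc
    obtain ⟨a, ha, b, hb, rfl⟩ := mem_add.1 hc.1
    have hdisj := hpart _ hc.2
    have hself : a + b ∈ (a + b) +ᵥ Hf := sc1_self_mem_coset hHf _
    have haB : a ∉ B := by
      intro haB
      refine disjoint_left.1 hdisj hself ?_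
      rw [add_comm]
      exact hmemS b (mem_union_left _ hb) a (mem_inter.2 ⟨haB, ha⟩)
    have hbA : b ∉ A := fun hbA =>
      disjoint_left.1 hdisj hself (hmemS a (mem_union_right _ ha) b (mem_inter.2 ⟨hb, hbA⟩))
    have hane : ((a +ᵥ Hf) ∩ B).Nonempty := by
      by_contra hne
      rw [not_nonempty_iff_eq_empty, ← disjoint_iff_inter_eq_empty] at hne
      exact disjoint_left.1 hdisj hself (hA₂S a ha hne (mem_vadd_finset.2 ⟨b, hb, rfl⟩))
    rw [QuotientAddGroup.mk_add]
    exact add_mem_add (mem_image_of_mem _ ((hA₁ a).2 ⟨ha, haB, hane⟩))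
      (mem_image_of_mem _ (by rw [hB₁def, mem_filter]; exact ⟨hb, hbA⟩))
  -- rows: «each `A_{αᵢ}` must have a `B_{β_σ(i)}` such that `A_{αᵢ} + B_{β_σ(i)} ⊆ F_j`»
  have hrow : ∀ q ∈ 𝒜, ∃ r ∈ ℬ, q + r ∈ 𝒞 := by
    intro q hq
    rw [h𝒜def, mem_image] at hq
    obtain ⟨a, ha, rfl⟩ := hq
    obtain ⟨haA, haB, ⟨b₀, hb₀⟩⟩ := (hA₁ a).1 ha
    rw [mem_inter] at hb₀
    have hb₀A : b₀ ∉ A := hbA_of haB hb₀.2 hb₀.1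
    obtain ⟨b, hb, hab⟩ := isNonExtendible_iff.1 hneA b₀ hb₀A
    obtain ⟨h, hh, hb₀e⟩ := mem_vadd_finset.1 hb₀.1
    have hbA : b ∉ A := by
      intro hbA
      apply hab
      have hmem := sc1_add_mem_of_periodic hYper hh (mem_inter.2 ⟨hb, hbA⟩)
      have e : b₀ + b = a + (h + b) := by rw [← hb₀e, vadd_eq_add]; abel
      rw [e]; exact add_mem_add haA (mem_inter.1 hmem).1
    refine ⟨QuotientAddGroup.mk b, mem_image_of_mem _ (by rw [hB₁def, mem_filter]; exact ⟨hb, hbA⟩),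
      ?_⟩
    rw [← QuotientAddGroup.mk_add]
    refine hmem𝒞 (add_mem_add haA hb) fun hsub => hab (hsub ?_)
    rw [sc1_mem_coset_iff hHf]
    have e : b₀ + b - (a + b) = h := by rw [← hb₀e, vadd_eq_add]; abel
    rw [e]; exact (hHf h).1 hh
  -- columns: «Likewise for each `B_{bᵢ}`»
  have hcol : ∀ r ∈ ℬ, ∃ q ∈ 𝒜, q + r ∈ 𝒞 := by
    intro r hr
    rw [hℬdef, mem_image] at hr
    obtain ⟨b, hb, rfl⟩ := hr
    rw [hB₁def, mem_filter] at hb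
    obtain ⟨x, hx⟩ := hB₂ b hb.1
    rw [mem_inter] at hx
    have hxb : x - b ∈ H := (sc1_mem_coset_iff hHf).1 hx.1
    have hxB : x ∉ B := hxB_of hb.1 hb.2 hx.2 hxb
    have hbx : b ∈ B ∩ (x +ᵥ Hf) := by
      refine mem_inter.2 ⟨hb.1, ?_⟩
      rw [sc1_mem_coset_iff hHf]; have := H.neg_mem hxb; rwa [neg_sub] at this
    have hsing := hsingle x hx.2 hxB b hbx
    -- `y = h₁ + b` is a hole of `B` in the coset of `b`
    have hyB : h₁ + b ∉ B := by
      intro hyB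
      have : h₁ + b ∈ B ∩ (x +ᵥ Hf) := by
        refine mem_inter.2 ⟨hyB, ?_⟩
        rw [sc1_mem_coset_iff hHf]
        have e : h₁ + b - x = h₁ + (b - x) := by abel
        rw [e]; exact H.add_mem hh₁H ((sc1_mem_coset_iff hHf).1 (mem_inter.1 hbx).2)
      rw [hsing, mem_singleton] at this
      exact hh₁0 (by simpa using this)
    obtain ⟨a, ha, hya⟩ := isNonExtendible_iff.1 hneB _ hyB
    have haB : a ∉ B := by
      intro haB
      apply hya
      have hmem := sc1_add_mem_of_periodic hYper hh₁ (mem_inter.2 ⟨haB, ha⟩)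
      have e : h₁ + b + a = b + (h₁ + a) := by abel
      rw [e]; exact add_mem_add hb.1 (mem_inter.1 hmem).2
    have hane : ((a +ᵥ Hf) ∩ B).Nonempty := by
      by_contra hne
      rw [not_nonempty_iff_eq_empty, ← disjoint_iff_inter_eq_empty] at hne
      apply hya
      have h1 : a +ᵥ b ∈ S := hA₂S a ha hne (mem_vadd_finset.2 ⟨b, hb.1, rfl⟩)
      have h2 := sc1_add_mem_of_periodic hSper hh₁ h1
      have e : h₁ + b + a = h₁ + (a +ᵥ b) := by rw [vadd_eq_add]; abel
      rw [e, add_comm B A]; exact hSsub h2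
    refine ⟨QuotientAddGroup.mk a, mem_image_of_mem _ ((hA₁ a).2 ⟨ha, haB, hane⟩), ?_⟩
    rw [← QuotientAddGroup.mk_add]
    refine hmem𝒞 (add_mem_add ha hb.1) fun hsub => hya ?_
    rw [add_comm B A]
    refine hsub ?_
    rw [sc1_mem_coset_iff hHf]
    have e : h₁ + b + a - (a + b) = h₁ := by abel
    rw [e]; exact hh₁H
  -- «there are at least two distinct partially filled `H`-cosets in `A + B`»
  have h𝒞2 : 2 ≤ #𝒞 := by
    -- one partially filled coset: `A + B` is aperiodic but `H ≠ 0`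
    obtain ⟨c₁, hc₁, hc₁n⟩ : ∃ c₁ ∈ A + B, ¬ (c₁ +ᵥ Hf ⊆ A + B) := by
      by_contra hall
      push Not at hall
      have : h₁ ∈ (A + B).addStab := by
        rw [mem_addStab hABne]
        refine eq_of_subset_of_card_le (fun w hw => ?_) (by rw [card_vadd_finset])
        obtain ⟨c, hc, rfl⟩ := mem_vadd_finset.1 hw
        exact hall c hc (mem_vadd_finset.2 ⟨h₁, hh₁, by rw [vadd_eq_add, vadd_eq_add, add_comm]⟩)
      rw [haper, mem_singleton] at this
      exact hh₁0 this
    have hq₁ := hmem𝒞 hc₁ hc₁n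
    by_contra hlt
    have hle : #𝒞 ≤ 1 := by omega
    apply hABqp
    -- `A + B = P ∪ Q` with `P` the part outside the coset of `c₁`
    have hPQ : (A + B) \ (c₁ +ᵥ Hf) ∪ (A + B) ∩ (c₁ +ᵥ Hf) = A + B := sdiff_union_inter _ _
    rw [← hPQ]
    refine isQuasiPeriodic_union_of_isPeriodicWith hH ?_ ?_ ?_
    · -- `P` is `H`-periodic
      have key : ∀ h ∈ Hf, ∀ z ∈ (A + B) \ (c₁ +ᵥ Hf), h + z ∈ (A + B) \ (c₁ +ᵥ Hf) := by
        intro h hh z hz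
        rw [mem_sdiff] at hz ⊢
        have hfull : z +ᵥ Hf ⊆ A + B := by
          by_contra hzn
          have := card_le_one.1 hle _ (hmem𝒞 hz.1 hzn) _ hq₁
          exact hz.2 ((sc1_mem_coset_iff hHf).2 (ex.1 this))
        refine ⟨hfull (mem_vadd_finset.2 ⟨h, hh, by rw [vadd_eq_add, add_comm]⟩), fun hmem => hz.2 ?_⟩
        rw [sc1_mem_coset_iff hHf] at hmem ⊢
        have e : z - c₁ = (h + z - c₁) - h := by abel
        rw [e]; exact H.sub_mem hmem ((hHf h).1 hh)
      intro h hh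
      refine eq_of_subset_of_card_le (fun w hw => ?_) (by rw [card_vadd_finset])
      obtain ⟨z, hz, rfl⟩ := mem_vadd_finset.1 hw
      exact key h ((hHf h).2 hh) z hz
    · obtain ⟨s, hs⟩ := hSne
      exact ⟨s, mem_sdiff.2 ⟨hSsub hs, fun hmem => disjoint_left.1 (hpart c₁ hc₁n) hmem hs⟩⟩
    · intro x hx y hy
      have hx' := (sc1_mem_coset_iff hHf).1 (mem_inter.1 hx).2
      have hy' := (sc1_mem_coset_iff hHf).1 (mem_inter.1 hy).2
      have := H.sub_mem hx' hy'; rwa [sub_sub_sub_cancel_right] at this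
  -- Proposition 5.5
  have hℬ2 : 2 ≤ #ℬ := by rw [hℬ𝒜]; omega
  have h55 := exists_two_edges_or_card_eq_two h𝒞sub (by omega) hℬ2 h𝒞2 hrow hcol
  rcases h55 with ⟨qa, hqa, qa', hqa', rb, hrb, rb', hrb', hqq, -, hc, hc', hcc⟩ | ⟨h2, -⟩
  swap
  · omega
  -- lift the two edges
  rw [h𝒜def, mem_image] at hqa hqa'
  obtain ⟨a, ha, rfl⟩ := hqa
  obtain ⟨a', ha', rfl⟩ := hqa'
  rw [hℬdef, mem_image] at hrb hrb'
  obtain ⟨b, hb, rfl⟩ := hrb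
  obtain ⟨b', hb', rfl⟩ := hrb'
  rw [hB₁def, mem_filter] at hb hb'
  obtain ⟨haA, haB, ⟨β, hβ⟩⟩ := (hA₁ a).1 ha
  obtain ⟨ha'A, ha'B, ⟨β', hβ'⟩⟩ := (hA₁ a').1 ha'
  rw [mem_inter] at hβ hβ'
  have hβA : β ∉ A := hbA_of haB hβ.2 hβ.1
  have hβ'A : β' ∉ A := hbA_of ha'B hβ'.2 hβ'.1
  have hsβ := hsingle a haA haB β (mem_inter.2 ⟨hβ.2, hβ.1⟩)
  have hsβ' := hsingle a' ha'A ha'B β' (mem_inter.2 ⟨hβ'.2, hβ'.1⟩)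
  -- the two sum cosets are partially filled, distinct, and disjoint from `S`
  have hpart_of : ∀ {u v : G}, (QuotientAddGroup.mk u : G ⧸ H) + QuotientAddGroup.mk v ∈ 𝒞 →
      ¬ ((u + v) +ᵥ Hf ⊆ A + B) := by
    intro u v huv
    rw [h𝒞def, mem_image] at huv
    obtain ⟨c, hc, hcuv⟩ := huv
    rw [mem_filter] at hc
    rw [← QuotientAddGroup.mk_add, ex] at hcuv
    rw [← sc1_coset_eq_of_sub_mem hHf hcuv]
    exact hc.2
  have hd1 := hpart _ (hpart_of hc)
  have hd2 := hpart _ (hpart_of hc')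
  have hne12 : Disjoint ((a + b) +ᵥ Hf) ((a' + b') +ᵥ Hf) := by
    rw [disjoint_left]
    intro w hw hw'
    apply hcc
    rw [← QuotientAddGroup.mk_add, ← QuotientAddGroup.mk_add, ex]
    rw [sc1_mem_coset_iff hHf] at hw hw'
    have := H.sub_mem hw' hw; rwa [sub_sub_sub_cancel_left] at this
  have hneaa : Disjoint (a +ᵥ Hf) (a' +ᵥ Hf) := by
    rw [disjoint_left]
    intro w hw hw'
    apply hqq
    rw [ex]
    rw [sc1_mem_coset_iff hHf] at hw hw'
    have := H.sub_mem hw' hw; rwa [sub_sub_sub_cancel_left] at this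
  -- (55), lower bound for `|A + B|`: `S`, `b + A_a`, `b' + A_{a'}` and the rest
  set Aa : Finset G := A ∩ (a +ᵥ Hf) with hAadef
  set Aa' : Finset G := A ∩ (a' +ᵥ Hf) with hAa'def
  have hbAa : b +ᵥ Aa ⊆ (A + B) ∩ ((a + b) +ᵥ Hf) := by
    intro w hw
    obtain ⟨x, hx, rfl⟩ := mem_vadd_finset.1 hw
    rw [hAadef, mem_inter] at hx
    refine mem_inter.2 ⟨by rw [vadd_eq_add, add_comm b x]; exact add_mem_add hx.1 hb.1, ?_⟩
    rw [sc1_mem_coset_iff hHf]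
    have e : (b +ᵥ x) - (a + b) = x - a := by rw [vadd_eq_add]; abel
    rw [e]; exact (sc1_mem_coset_iff hHf).1 hx.2
  have hb'Aa' : b' +ᵥ Aa' ⊆ (A + B) ∩ ((a' + b') +ᵥ Hf) := by
    intro w hw
    obtain ⟨x, hx, rfl⟩ := mem_vadd_finset.1 hw
    rw [hAa'def, mem_inter] at hx
    refine mem_inter.2 ⟨by rw [vadd_eq_add, add_comm b' x]; exact add_mem_add hx.1 hb'.1, ?_⟩
    rw [sc1_mem_coset_iff hHf]
    have e : (b' +ᵥ x) - (a' + b') = x - a' := by rw [vadd_eq_add]; abel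
    rw [e]; exact (sc1_mem_coset_iff hHf).1 hx.2
  set U : Finset G := S ∪ (b +ᵥ Aa) ∪ (b' +ᵥ Aa') with hUdef
  have hUsub : U ⊆ A + B := by
    refine union_subset (union_subset hSsub fun w hw => (mem_inter.1 (hbAa hw)).1) fun w hw =>
      (mem_inter.1 (hb'Aa' hw)).1
  have hUcard : #U = #S + #Aa + #Aa' := by
    have hd₁ : Disjoint S (b +ᵥ Aa) := by
      rw [disjoint_left]; intro w hwS hw
      exact disjoint_left.1 hd1 (mem_inter.1 (hbAa hw)).2 hwS
    have hd₂ : Disjoint (S ∪ (b +ᵥ Aa)) (b' +ᵥ Aa') := by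
      rw [disjoint_left]; intro w hw hw'
      have hw'c := (mem_inter.1 (hb'Aa' hw')).2
      rcases mem_union.1 hw with hwS | hw
      · exact disjoint_left.1 hd2 hw'c hwS
      · exact disjoint_left.1 hne12 (mem_inter.1 (hbAa hw)).2 hw'c
    rw [hUdef, card_union_of_disjoint hd₂, card_union_of_disjoint hd₁, card_vadd_finset,
      card_vadd_finset]
  have hUrest : #U + #((A + B) \ U) = #(A + B) := by
    rw [add_comm, card_sdiff_add_card_eq_card hUsub]
  -- (53)/(54) side: the holes of `B ∪ A` in the cosets of `a` and `a'`
  have htrace : ∀ {a₀ β₀ : G}, β₀ ∈ B → β₀ ∉ A → B ∩ (a₀ +ᵥ Hf) = {β₀} →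
      #((a₀ +ᵥ Hf) \ (B ∪ A)) + (1 + #(A ∩ (a₀ +ᵥ Hf))) = #Hf := by
    intro a₀ β₀ hβ₀B hβ₀A hs
    have h1 : (a₀ +ᵥ Hf) ∩ (B ∪ A) = insert β₀ (A ∩ (a₀ +ᵥ Hf)) := by
      ext w
      rw [mem_inter, mem_union, mem_insert, mem_inter]
      constructor
      · rintro ⟨hw, hwB | hwA⟩
        · left
          have : w ∈ B ∩ (a₀ +ᵥ Hf) := mem_inter.2 ⟨hwB, hw⟩
          rw [hs, mem_singleton] at this
          exact this
        · exact Or.inr ⟨hwA, hw⟩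
      · rintro (rfl | ⟨hwA, hw⟩)
        · have : w ∈ B ∩ (a₀ +ᵥ Hf) := by rw [hs]; exact mem_singleton_self _
          exact ⟨(mem_inter.1 this).2, Or.inl hβ₀B⟩
        · exact ⟨hw, Or.inr hwA⟩
    have := card_sdiff_add_card_inter (a₀ +ᵥ Hf) (B ∪ A)
    rw [h1, card_insert_of_notMem (fun h => hβ₀A (mem_inter.1 h).1), card_vadd_finset] at this
    omega
  have ht1 := htrace hβ.2 hβA hsβ
  have ht2 := htrace hβ'.2 hβ'A hsβ'
  rw [← hAadef] at ht1
  rw [← hAa'def] at ht2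
  have hV : #(B ∪ A) + #((a +ᵥ Hf) \ (B ∪ A)) + #((a' +ᵥ Hf) \ (B ∪ A)) ≤ #((B ∪ A) + Hf) := by
    have hsub0 : B ∪ A ⊆ (B ∪ A) + Hf := fun x hx => mem_add.2 ⟨x, hx, 0, h0Hf, add_zero x⟩
    have hsubc : ∀ {a₀ : G}, a₀ ∈ A → (a₀ +ᵥ Hf) \ (B ∪ A) ⊆ (B ∪ A) + Hf := by
      intro a₀ ha₀ x hx
      obtain ⟨h, hh, rfl⟩ := mem_vadd_finset.1 (mem_sdiff.1 hx).1
      exact mem_add.2 ⟨a₀, mem_union_right _ ha₀, h, hh, rfl⟩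
    have hdA : Disjoint (B ∪ A) ((a +ᵥ Hf) \ (B ∪ A)) := disjoint_sdiff
    have hdB : Disjoint (B ∪ A ∪ (a +ᵥ Hf) \ (B ∪ A)) ((a' +ᵥ Hf) \ (B ∪ A)) := by
      rw [disjoint_left]; intro w hw hw'
      rcases mem_union.1 hw with hw | hw
      · exact (mem_sdiff.1 hw').2 hw
      · exact disjoint_left.1 hneaa (mem_sdiff.1 hw).1 (mem_sdiff.1 hw').1
    have := card_le_card (union_subset (union_subset hsub0 (hsubc haA)) (hsubc ha'A))
    rwa [card_union_of_disjoint hdB, card_union_of_disjoint hdA] at this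
  have hui : #(B ∪ A) + #(B ∩ A) = #B + #A := card_union_add_card_inter B A
  -- `|H| = 2` and `A + B ⊆ U`
  have hHfcard : #Hf = 2 := by omega
  have hrest : (A + B) \ U = ∅ := by
    rw [← card_eq_zero]; omega
  have hABU : A + B ⊆ U := by
    intro w hw; by_contra hwU
    have : w ∈ (A + B) \ U := mem_sdiff.2 ⟨hw, hwU⟩
    rw [hrest] at this
    exact notMem_empty w this
  -- the periodic set `P = A + B + H` has at most two holes: contradiction with Claim 5
  set P : Finset G := (A + B) + Hf with hPdef
  have hABP : A + B ⊆ P := fun x hx => mem_add.2 ⟨x, hx, 0, h0Hf, add_zero x⟩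
  have hPne : P.Nonempty := hABne.mono hABP
  have hPst : P.addStab ≠ {0} := by
    intro h0
    have : h₁ ∈ P.addStab := by
      rw [mem_addStab hPne, hPdef, add_comm (A + B) Hf, ← vadd_add_assoc,
        sc1_coset_eq_of_sub_mem hHf (x := h₁) (y := 0) (by rw [sub_zero]; exact hh₁H), zero_vadd]
    rw [h0, mem_singleton] at this
    exact hh₁0 this
  have h3 := hP3 P hABP hPst
  have hhole : ∀ {u v : G}, u + v ∈ A + B → #(((u + v) +ᵥ Hf) \ (A + B)) ≤ 1 := by
    intro u v huv
    have hsub : ((u + v) +ᵥ Hf) \ (A + B) ⊆ ((u + v) +ᵥ Hf).erase (u + v) := by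
      intro w hw
      rw [mem_sdiff] at hw
      exact mem_erase.2 ⟨fun h => hw.2 (h ▸ huv), hw.1⟩
    have := card_le_card hsub
    rw [card_erase_of_mem (sc1_self_mem_coset hHf _), card_vadd_finset] at this
    omega
  have hPsub : P \ (A + B) ⊆ ((a + b) +ᵥ Hf) \ (A + B) ∪ ((a' + b') +ᵥ Hf) \ (A + B) := by
    intro z hz
    rw [mem_sdiff] at hz
    obtain ⟨c, hc, h, hh, rfl⟩ := mem_add.1 hz.1
    rw [mem_union, mem_sdiff, mem_sdiff]
    have hcU := hABU hc
    rw [hUdef, mem_union, mem_union] at hcU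
    rcases hcU with (hcS | hcb) | hcb'
    · exact absurd (hSsub (by rw [add_comm]; exact sc1_add_mem_of_periodic hSper hh hcS)) hz.2
    · left
      refine ⟨?_, hz.2⟩
      have hcc := (sc1_mem_coset_iff hHf).1 (mem_inter.1 (hbAa hcb)).2
      rw [sc1_mem_coset_iff hHf]
      have e : c + h - (a + b) = (c - (a + b)) + h := by abel
      rw [e]; exact H.add_mem hcc ((hHf h).1 hh)
    · right
      refine ⟨?_, hz.2⟩
      have hcc := (sc1_mem_coset_iff hHf).1 (mem_inter.1 (hb'Aa' hcb')).2
      rw [sc1_mem_coset_iff hHf]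
      have e : c + h - (a' + b') = (c - (a' + b')) + h := by abel
      rw [e]; exact H.add_mem hcc ((hHf h).1 hh)
  have := (card_le_card hPsub).trans (card_union_le _ _)
  have h1 := hhole (add_mem_add haA hb.1)
  have h2 := hhole (add_mem_add ha'A hb'.1)
  omega

/-! ### Subcase 1 -/

/-- **Subcase 1 for the translated pair** (print pp. 29–31): `|A + B| = |A| + |B|`, `A + B` not
quasi-periodic ((45)), `d⊆(A + B, 𝒫) ≥ 3` (Claim 5), `(A, B)` non-extendible, `A` not quasi-periodic
(Claim 4), `B(e) = B ∩ A ≠ ∅`, `e = 0` maximal («`|(e + B) ∩ A|` is maximal subject to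
`|(e + B) ∩ A| < |B|`») and `A(e) + B(e) = (B ∪ A) + (B ∩ A)` periodic.  Then («In view of the result of
the previous paragraph, Claim 11 and Lemma 5.6 … it follows that `n ≥ 3`, else the proof is complete»,
and `n ≥ 3` is impossible by `sc1_false_of_three_le`) `A = A′ ∪ A₁ ∪ A₂` with `A′ ≠ ∅` periodic with
maximal period `K ≠ 0` and `A₁`, `A₂` each inside one `K`-coset — the hypothesis of Lemma 5.6.
[cite: Grynkiewicz2009, §6 Subcase 1 (pp. 29–31)] -/
theorem subcaseOne_nearlyPeriodic {A B : Finset G}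
    (hAB : #(A + B) = #A + #B) (hABqp : ¬ IsQuasiPeriodic (A + B))
    (hP3 : ∀ P : Finset G, A + B ⊆ P → P.addStab ≠ {0} → 3 ≤ #(P \ (A + B)))
    (hneA : IsNonExtendible A B) (hneB : IsNonExtendible B A) (hAqp : ¬ IsQuasiPeriodic A)
    (hYne : (B ∩ A).Nonempty)
    (hmax : ∀ x : G, ¬ (x +ᵥ B ⊆ A) → #((x +ᵥ B) ∩ A) ≤ #(B ∩ A))
    (hper : ((B ∪ A) + (B ∩ A)).addStab ≠ {0}) :
    ∃ (K : AddSubgroup G) (A' A₁ A₂ : Finset G) (a₁ a₂ : G), A = A' ∪ A₁ ∪ A₂ ∧ A'.Nonempty ∧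
      K ≠ ⊥ ∧ (∀ g, g ∈ A'.addStab ↔ g ∈ K) ∧ (∀ x ∈ A₁, x - a₁ ∈ K) ∧ (∀ x ∈ A₂, x - a₂ ∈ K) := by
  classical
  set S : Finset G := (B ∪ A) + (B ∩ A) with hSdef
  set Hf : Finset G := S.addStab with hHfdef
  set H : AddSubgroup G := AddAction.stabilizer G S with hHdef
  have hXne : (B ∪ A).Nonempty := hYne.mono (inter_subset_right.trans subset_union_right)
  have hSne : S.Nonempty := hXne.add hYne
  have hHf : ∀ g, g ∈ Hf ↔ g ∈ H := fun g => by
    rw [hHfdef, mem_addStab hSne, hHdef, AddAction.mem_stabilizer_iff]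
  have hSper : ∀ h ∈ Hf, h +ᵥ S = S := fun h hh => (mem_addStab hSne).1 hh
  have hH : H ≠ ⊥ := by
    intro hbot
    apply hper
    refine Subset.antisymm (fun g hg => ?_) (singleton_subset_iff.2 hSne.zero_mem_addStab)
    have := (hHf g).1 hg
    rw [hbot, AddSubgroup.mem_bot] at this
    rw [mem_singleton]; exact this
  -- Claim 11: `B(e)` is `H`-periodic
  have hYper : ∀ h ∈ Hf, h +ᵥ (B ∩ A) = B ∩ A := by
    intro h hh
    have h11 := addStab_eTransform_subset (0 : G) hneA hneB (by rwa [zero_vadd])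
    simp only [zero_vadd] at h11
    exact (mem_addStab hYne).1 (h11 hh)
  have hSsub : S ⊆ A + B := sc1_union_add_inter_subset A B
  -- Kneser's theorem, (54)
  have hYH : (B ∩ A) + Hf = B ∩ A := by
    refine Subset.antisymm (fun z hz => ?_)
      (fun z hz => mem_add.2 ⟨z, hz, 0, (hHf 0).2 H.zero_mem, add_zero z⟩)
    obtain ⟨y, hy, h, hh, rfl⟩ := mem_add.1 hz
    rw [add_comm]; exact sc1_add_mem_of_periodic hYper hh hy
  have kn : #((B ∪ A) + Hf) + #(B ∩ A) ≤ #S + #Hf := by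
    have k := add_kneser (B ∪ A) (B ∩ A)
    rw [hYH] at k
    exact k
  -- the symmetric copies (`A₂` is `H`-periodic, `a + B ⊆ S` for `a ∈ A₂`)
  have kn' : #((A ∪ B) + Hf) + #(A ∩ B) ≤ #S + #Hf := by rwa [union_comm, inter_comm] at kn
  have hBA : #(B + A) = #B + #A := by rw [add_comm, hAB, add_comm]
  have hBAqp : ¬ IsQuasiPeriodic (B + A) := by rwa [add_comm]
  have hSsub' : S ⊆ B + A := by rw [add_comm]; exact hSsub
  have hA₂S : ∀ x ∈ A, Disjoint (x +ᵥ Hf) B → x +ᵥ B ⊆ S := fun x hx hd =>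
    sc1_vadd_subset_of_disjoint (A := B) (B := A) hHf hH hSper hSne hSsub' kn' hBA hBAqp hx hd
  have hA₂per : ∀ x ∈ A, Disjoint (x +ᵥ Hf) B → ∀ h ∈ Hf, h + x ∈ A := fun x hx hd h hh =>
    sc1_add_mem_of_disjoint (A := B) (B := A) hHf hH hSper hSne hSsub' kn' hBA hBAqp hneA hx hd hh
  -- `A₁` and `n = |φ_H(A₁)|`
  set A₁ : Finset G := A.filter (fun a => a ∉ B ∧ ((a +ᵥ Hf) ∩ B).Nonempty) with hA₁def
  have hA₁ : ∀ a, a ∈ A₁ ↔ a ∈ A ∧ a ∉ B ∧ ((a +ᵥ Hf) ∩ B).Nonempty := fun a => by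
    rw [hA₁def, mem_filter]
  set 𝒜 : Finset (G ⧸ H) := A₁.image (QuotientAddGroup.mk : G → G ⧸ H) with h𝒜def
  by_cases hn : 3 ≤ #𝒜
  · -- «`n ≥ 3`»: impossible
    exfalso
    obtain ⟨q, hq⟩ : 𝒜.Nonempty := card_pos.1 (by omega)
    obtain ⟨a₀, ha₀, -⟩ := mem_image.1 hq
    obtain ⟨ha₀A, ha₀B, ⟨b', hb'⟩⟩ := (hA₁ a₀).1 ha₀
    rw [mem_inter] at hb'
    have hab : a₀ - b' ∈ H := by
      have := H.neg_mem ((sc1_mem_coset_iff hHf).1 hb'.1)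
      rwa [neg_sub] at this
    have hB₂ : ∀ b ∈ B, ((b +ᵥ Hf) ∩ A).Nonempty := fun b hb =>
      sc1_inter_nonempty hHf hYper hmax ha₀A ha₀B hb'.2 hab hb
    have hsingle : ∀ a ∈ A, a ∉ B → ∀ b ∈ B ∩ (a +ᵥ Hf), B ∩ (a +ᵥ Hf) = {b} :=
      fun a ha haB b hb => sc1_inter_coset_eq_singleton hHf hYper hmax hA₂per hAqp ha haB hb
    exact sc1_false_of_three_le hHf hH hSper hSne hSdef kn hAB hABqp hP3 hneA hneB hYper hA₂S hB₂
      hsingle hA₁ hn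
  -- «`n ≤ 2`»: the shape of Lemma 5.6, with `A′ = (B ∩ A) ∪ A₂` and `K = H(A′) ⊇ H`
  push Not at hn
  set A' : Finset G := A.filter (fun a => a ∈ B ∨ Disjoint (a +ᵥ Hf) B) with hA'def
  have hA'A : A' ⊆ A := by rw [hA'def]; exact filter_subset _ _
  have hA'per : ∀ h ∈ Hf, ∀ x ∈ A', h + x ∈ A' := by
    intro h hh x hx
    rw [hA'def, mem_filter] at hx ⊢
    rcases hx.2 with hxB | hxd
    · have := sc1_add_mem_of_periodic hYper hh (mem_inter.2 ⟨hxB, hx.1⟩)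
      exact ⟨(mem_inter.1 this).2, Or.inl (mem_inter.1 this).1⟩
    · refine ⟨hA₂per x hx.1 hxd h hh, Or.inr ?_⟩
      rwa [sc1_coset_eq_of_sub_mem hHf (x := h + x) (y := x)
        (by rw [add_sub_cancel_right]; exact (hHf h).1 hh)]
  have hA'ne : A'.Nonempty := by
    obtain ⟨y, hy⟩ := hYne
    refine ⟨y, ?_⟩
    rw [hA'def, mem_filter]
    exact ⟨(mem_inter.1 hy).2, Or.inl (mem_inter.1 hy).1⟩
  have hA'stab : ∀ h ∈ Hf, h +ᵥ A' = A' := fun h hh =>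
    eq_of_subset_of_card_le (fun z hz => by
      obtain ⟨x, hx, rfl⟩ := mem_vadd_finset.1 hz
      exact hA'per h hh x hx) (by rw [card_vadd_finset])
  set K : AddSubgroup G := AddAction.stabilizer G A' with hKdef
  have hK : ∀ g, g ∈ A'.addStab ↔ g ∈ K := fun g => by
    rw [mem_addStab hA'ne, hKdef, AddAction.mem_stabilizer_iff]
  have hHK : H ≤ K := by
    intro g hg
    rw [hKdef, AddAction.mem_stabilizer_iff]
    exact hA'stab g ((hHf g).2 hg)
  have hKne : K ≠ ⊥ := fun hbot => hH (le_bot_iff.1 (hbot ▸ hHK))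
  have hrest : ∀ x ∈ A, x ∉ A' → x ∈ A₁ := by
    intro x hx hxA'
    rw [hA₁]
    rw [hA'def, mem_filter, not_and_or] at hxA'
    rcases hxA' with hxA' | hxA'
    · exact absurd hx hxA'
    rw [not_or] at hxA'
    exact ⟨hx, hxA'.1, by rw [← not_disjoint_iff_nonempty_inter]; exact hxA'.2⟩
  by_cases h𝒜e : 𝒜 = ∅
  · -- `A₁ = ∅`
    refine ⟨K, A', ∅, ∅, 0, 0, ?_, hA'ne, hKne, hK, by simp, by simp⟩
    rw [union_empty, union_empty]
    refine Subset.antisymm (fun x hx => ?_) hA'A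
    by_contra hxA'
    have := mem_image_of_mem (QuotientAddGroup.mk : G → G ⧸ H) (hrest x hx hxA')
    rw [← h𝒜def, h𝒜e] at this
    exact notMem_empty _ this
  obtain ⟨q₁, hq₁⟩ := nonempty_iff_ne_empty.2 h𝒜e
  obtain ⟨a₁, ha₁, rfl⟩ := mem_image.1 hq₁
  -- a second representative covering `𝒜` (at most two cosets)
  have hex : ∃ a₂ ∈ A₁, ∀ q ∈ 𝒜, q = QuotientAddGroup.mk a₁ ∨ q = QuotientAddGroup.mk a₂ := by
    by_cases h2 : ∃ q ∈ 𝒜, q ≠ QuotientAddGroup.mk a₁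
    · obtain ⟨q₂, hq₂, hne⟩ := h2
      obtain ⟨a₂, ha₂, rfl⟩ := mem_image.1 hq₂
      refine ⟨a₂, ha₂, fun q hq => ?_⟩
      by_contra hq'
      push Not at hq'
      have hsub : ({QuotientAddGroup.mk a₁, QuotientAddGroup.mk a₂, q} : Finset (G ⧸ H)) ⊆ 𝒜 := by
        intro r hr
        simp only [mem_insert, mem_singleton] at hr
        rcases hr with rfl | rfl | rfl
        exacts [hq₁, hq₂, hq]
      have hcard := card_le_card hsub
      rw [card_insert_of_notMem, card_pair (Ne.symm hq'.2)] at hcard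
      · omega
      · simp only [mem_insert, mem_singleton, not_or]
        exact ⟨Ne.symm hne, Ne.symm hq'.1⟩
    · push Not at h2
      exact ⟨a₁, ha₁, fun q hq => Or.inl (h2 q hq)⟩
  obtain ⟨a₂, ha₂, hcover⟩ := hex
  set A₁' : Finset G := A₁.filter (fun x => x - a₁ ∈ Hf) with hA₁'def
  refine ⟨K, A', A₁', A₁ \ A₁', a₁, a₂, ?_, hA'ne, hKne, hK, ?_, ?_⟩
  · ext x
    simp only [mem_union, mem_sdiff]
    constructor
    · intro hx
      by_cases hxA' : x ∈ A'
      · exact Or.inl (Or.inl hxA')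
      · have hx1 := hrest x hx hxA'
        by_cases hx1' : x ∈ A₁'
        · exact Or.inl (Or.inr hx1')
        · exact Or.inr ⟨hx1, hx1'⟩
    · rintro ((hx | hx) | ⟨hx, -⟩)
      · exact hA'A hx
      · rw [hA₁'def, mem_filter] at hx
        exact ((hA₁ x).1 hx.1).1
      · exact ((hA₁ x).1 hx).1
  · intro x hx
    rw [hA₁'def, mem_filter] at hx
    exact hHK ((hHf _).1 hx.2)
  · intro x hx
    rw [mem_sdiff] at hx
    obtain ⟨hx1, hx2⟩ := hx
    have hne : x - a₁ ∉ Hf := fun h => hx2 (by rw [hA₁'def, mem_filter]; exact ⟨hx1, h⟩)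
    rcases hcover _ (mem_image_of_mem _ hx1) with h | h
    · exact absurd ((hHf _).2 (QuotientAddGroup.eq_iff_sub_mem.1 h)) hne
    · exact hHK (QuotientAddGroup.eq_iff_sub_mem.1 h)

/-- **§6 CASE I, Subcase 1** (print pp. 29–31), in the form used by the induction of Theorem 4.1: let
`G` be finite, `0 ∈ A ∩ B`, `|A|, |B| ≥ 3`, `|A + B| = |A| + |B|`, `d⊆(A + B, 𝒫) ≥ 3` (Claim 5),
`(A, B)` non-extendible, `⟨A⟩ = G` and `A` not quasi-periodic (Claim 4), `A + B` not quasi-periodic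
((45)); let `e` have `B(e) = (e + B) ∩ A ≠ ∅` and `|(e + B) ∩ A|` maximal subject to
`|(e + B) ∩ A| < |B|` (`exists_max_eTransform`).  If `A(e) + B(e)` is periodic, then (17) holds:
`|(A ∪ {α}) + (B ∪ {β})| = |A ∪ {α}| + |B ∪ {β}| − 1` for some `α ∉ A`, `β ∉ B` (stated, as everywhere
in this port, as `|…| + 1 = |A ∪ {α}| + |B ∪ {β}|`).  Proof: `subcaseOne_nearlyPeriodic` for the
translated pair `(A, e + B)` and Lemma 5.6 (`seventeen_of_nearly_periodic`) for `(A, B)`.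
[cite: Grynkiewicz2009, §6 Subcase 1 (proof of Thm 4.1, pp. 29–31)] -/
theorem subcaseOne_seventeen [Fintype G] {A B : Finset G} {e : G}
    (h0A : (0 : G) ∈ A) (h0B : (0 : G) ∈ B) (hA3 : 3 ≤ #A) (hB3 : 3 ≤ #B)
    (hAB : #(A + B) = #A + #B)
    (hP3 : ∀ P : Finset G, A + B ⊆ P → P.addStab ≠ {0} → 3 ≤ #(P \ (A + B)))
    (hneA : IsNonExtendible A B) (hneB : IsNonExtendible B A)
    (hgen : AddSubgroup.closure (A : Set G) = ⊤) (hAqp : ¬ IsQuasiPeriodic A)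
    (hABqp : ¬ IsQuasiPeriodic (A + B))
    (he : ((e +ᵥ B) ∩ A).Nonempty)
    (hmax : ∀ e' ∈ A - B, #((e' +ᵥ B) ∩ A) < #B → #((e' +ᵥ B) ∩ A) ≤ #((e +ᵥ B) ∩ A))
    (hper : (((e +ᵥ B) ∪ A) + ((e +ᵥ B) ∩ A)).addStab ≠ {0}) :
    ∃ α β : G, #(insert α A + insert β B) + 1 = #(insert α A) + #(insert β B) := by
  classical
  have hsum : A + (e +ᵥ B) = e +ᵥ (A + B) := by
    rw [add_comm A (e +ᵥ B), vadd_add_assoc, add_comm B A]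
  have hAB' : #(A + (e +ᵥ B)) = #A + #(e +ᵥ B) := by
    rw [hsum, card_vadd_finset, card_vadd_finset, hAB]
  have hABqp' : ¬ IsQuasiPeriodic (A + (e +ᵥ B)) := by
    rw [hsum, isQuasiPeriodic_vadd_iff]; exact hABqp
  have hP3' : ∀ P : Finset G, A + (e +ᵥ B) ⊆ P → P.addStab ≠ {0} →
      3 ≤ #(P \ (A + (e +ᵥ B))) := by
    rw [hsum]; exact forall_card_sdiff_vadd e hP3
  have hneA' : IsNonExtendible A (e +ᵥ B) := hneA.vadd_right e
  have hneB' : IsNonExtendible (e +ᵥ B) A := hneB.vadd_left e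
  have hmax' : ∀ x : G, ¬ (x +ᵥ (e +ᵥ B) ⊆ A) →
      #((x +ᵥ (e +ᵥ B)) ∩ A) ≤ #((e +ᵥ B) ∩ A) := by
    intro x hx
    rw [vadd_vadd] at hx ⊢
    by_cases hne : (((x + e) +ᵥ B) ∩ A).Nonempty
    · have hmem : x + e ∈ A - B := eTransform_inter_nonempty_iff.1 hne
      have hlt : #(((x + e) +ᵥ B) ∩ A) < #B := by
        have hss : ((x + e) +ᵥ B) ∩ A ⊂ (x + e) +ᵥ B := by
          refine lt_of_le_of_ne inter_subset_left fun heq => hx ?_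
          rw [← heq]; exact inter_subset_right
        have := card_lt_card hss
        rwa [card_vadd_finset] at this
      exact hmax _ hmem hlt
    · rw [not_nonempty_iff_eq_empty.1 hne, card_empty]; exact Nat.zero_le _
  obtain ⟨K, A', A₁, A₂, a₁, a₂, hA, hA'ne, hK, hKst, hA₁, hA₂⟩ :=
    subcaseOne_nearlyPeriodic hAB' hABqp' hP3' hneA' hneB' hAqp he hmax' hper
  haveI : DecidableEq (G ⧸ K) := Classical.decEq _
  exact seventeen_of_nearly_periodic hA hA'ne hK hKst hA₁ hA₂ hA3 hB3 h0A h0B hAB hP3 hneA hneB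
    hgen hAqp

end Grynkiewicz2009

end Literature.Combinatorics.Additive
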